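import Literature.NumberTheory.Sieve.CFSemigroupSeparation
import Literature.MeasureTheory.Hausdorff.SelfSimilarCode
import HarnessLib

/-!
# Positivity of the dimension `δ_A` of the limit set of `Γ_A` (support for `CFSemigroupCounting`)

We prove the first conjunct of the named fact
`Literature.NumberTheory.Sieve.MageeOhWinter2019_uniformCounting` unconditionally:

* `cfValue_mem_cfLimitSet`: for every digit sequence `d` with digits in `A` the real number
  `[0; d 0, d 1, …]` is an accumulation point of the orbit `Γ_A · i` (the orbit points
  `M_{2n} · i`, `M_{2n} = g_{d 0} ⋯ g_{d (2n-1)} ∈ Γ_A`, satisfy `|M_{2n} · i - x_{2n}| ≤ 1/q_{2n}`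
  and `x_{2n} → [0; d]`), i.e. `E_A ⊆ Λ(Γ_A)` [MageeOhWinter2019, §1: "the limit set … is the
  set of all accumulation points of an orbit"; §2.1 II];
* `cfDimension_pos`: `0 < δ_A = dim_H Λ(Γ_A)` for every finite `A ⊆ ℕ_{≥1}` with `#A ≥ 2`
  [MageeOhWinter2019, Thm. 1–2: "`δ > 0` is the Hausdorff dimension of the limit set"].

## Proof of `cfDimension_pos`

Classical "Hölder coding" argument (Falconer, *Fractal geometry*, Prop. 3.3 with Example 4.5;
Jarník 1928 for `E_2`): pick `α ≠ β` in `A` and code `ω ∈ {0,1}^ℕ` by the continued fraction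
`K(ω) = [0; c(ω_0), c(ω_1), …]`, `c(0) = α`, `c(1) = β`. By `cfValue_separation` two codes
that first differ at place `n` satisfy `|K ω - K ω'| ≥ c₀ L^{-n}`, `L = (B+1)²`,
`B = max α β`, while the points `Σ_k ω_k 3^{-k}` of the middle-thirds-type Cantor dust `T`
(ratio `1/3`, digits `{0,1}`) satisfy `|code ω - code ω'| ≤ (3/2) 3^{-n}`. Hence
`code ∘ K⁻¹ : K({0,1}^ℕ) → T` is `r`-Hölder with `r = log 3 / log L > 0` and onto, so
`1/2 ≤ dim_H T ≤ dim_H K({0,1}^ℕ) / r ≤ dim_H Λ(Γ_A) / r` by Moran's lower bound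
(`Literature.MeasureTheory.Hausdorff.CantorDust.le_dimH_range_code`) and
`HolderOnWith.dimH_image_le`; thus `δ_A ≥ r/2 > 0`.

## References

* M. Magee, H. Oh, D. Winter, J. reine angew. Math. 753 (2019) 89–135, §1, §2.1 II, Thm. 1–2.
  [MageeOhWinter2019]
* K. Falconer, *Fractal geometry*, 3rd ed. (2014), Prop. 3.3, Example 4.5.
-/

noncomputable section

open Filter Set
open Literature.MeasureTheory.Hausdorff
open scoped Topology MatrixGroups ENNReal NNReal

namespace Literature.NumberTheory.Sieve

/-! ### Orbit points and the limit set -/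

/-- An elementary Möbius estimate: for a real matrix `(a b; c e)` with `|ae - bc| = 1`,
`e ≥ 1`, the image of `i` is within `1/e` of the image `b/e` of `0`:
`(a i + b)/(c i + e) - b/e = (ae - bc) i / ((c i + e) e)`. [folklore] -/
theorem norm_moebius_I_sub_div_le {a b c e : ℝ} (hdet : |a * e - b * c| = 1) (he : 1 ≤ e) :
    ‖((a : ℂ) * Complex.I + b) / ((c : ℂ) * Complex.I + e) - (b : ℂ) / (e : ℂ)‖ ≤ 1 / e := by
  have he0 : (0 : ℝ) < e := zero_lt_one.trans_le he
  have hden : (c : ℂ) * Complex.I + e ≠ 0 := by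
    intro h
    have := congrArg Complex.re h
    simp at this
    linarith
  have he0' : (e : ℂ) ≠ 0 := by exact_mod_cast he0.ne'
  rw [div_sub_div _ _ hden he0']
  have hnum : ((a : ℂ) * Complex.I + b) * e - ((c : ℂ) * Complex.I + e) * b =
      ((a * e - b * c : ℝ) : ℂ) * Complex.I := by
    push_cast
    ring
  rw [hnum, norm_div, norm_mul, Complex.norm_real, Real.norm_eq_abs, hdet, one_mul,
    Complex.norm_I, norm_mul, Complex.norm_real, Real.norm_eq_abs, abs_of_pos he0]
  have hre : e ≤ ‖(c : ℂ) * Complex.I + e‖ := by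
    have h := Complex.abs_re_le_norm ((c : ℂ) * Complex.I + e)
    simp at h
    rwa [abs_of_pos he0] at h
  have h1 : (1 : ℝ) * e ≤ ‖(c : ℂ) * Complex.I + e‖ * e := by
    nlinarith
  rw [one_mul] at h1
  exact div_le_div_of_nonneg_left zero_le_one he0 h1

/-- The word matrix `M_{2n}` of an even word as an element of `SL₂(ℤ)` (`det M_{2n} = 1`).
[folklore] -/
def cfWordSL (d : ℕ → ℕ) (n : ℕ) : SL(2, ℤ) :=
  ⟨cfWord d (2 * n), by rw [det_cfWord, pow_mul]; simp⟩

/-- The orbit point `γ · i` of `γ = M_n(d) ∈ SL₂(ℤ)` is within `1/q_n` of the convergent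
`x_n = M_n(0) = p_n/q_n`. [folklore] -/
theorem norm_smul_I_sub_cfConv_le {d : ℕ → ℕ} (hd : ∀ i, 1 ≤ d i) {n : ℕ} (γ : SL(2, ℤ))
    (hγ : (γ : Matrix (Fin 2) (Fin 2) ℤ) = cfWord d n) :
    ‖((γ • UpperHalfPlane.I : UpperHalfPlane) : ℂ) - (cfConv d n : ℂ)‖ ≤ 1 / (cfDen d n : ℝ) := by
  have hdet : |(cfWord d n 0 0 : ℝ) * cfWord d n 1 1 - cfWord d n 0 1 * cfWord d n 1 0| = 1 := by
    have h := det_cfWord d n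
    rw [Matrix.det_fin_two] at h
    have h' : (cfWord d n 0 0 : ℝ) * cfWord d n 1 1 - cfWord d n 0 1 * cfWord d n 1 0 =
        (-1) ^ n := by exact_mod_cast h
    rw [h', abs_pow, abs_neg, abs_one, one_pow]
  have he : (1 : ℝ) ≤ (cfWord d n 1 1 : ℝ) := by exact_mod_cast one_le_cfDen hd n
  have h := norm_moebius_I_sub_div_le hdet he
  have hcoe : ((γ • UpperHalfPlane.I : UpperHalfPlane) : ℂ) =
      (((cfWord d n 0 0 : ℝ) : ℂ) * Complex.I + ((cfWord d n 0 1 : ℝ) : ℂ)) /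
        (((cfWord d n 1 0 : ℝ) : ℂ) * Complex.I + ((cfWord d n 1 1 : ℝ) : ℂ)) := by
    rw [UpperHalfPlane.coe_specialLinearGroup_apply]
    simp [hγ, UpperHalfPlane.coe_I]
  have hconv : ((cfConv d n : ℝ) : ℂ) =
      ((cfWord d n 0 1 : ℝ) : ℂ) / ((cfWord d n 1 1 : ℝ) : ℂ) := by
    rw [cfConv, Complex.ofReal_div]
    rfl
  rw [hcoe, hconv]
  exact h

/-- The orbit point `M_{2n} · i` is within `1/q_{2n}` of the convergent `x_{2n} = M_{2n}(0)`.
[folklore] -/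
theorem norm_cfWordSL_smul_I_sub_le {d : ℕ → ℕ} (hd : ∀ i, 1 ≤ d i) (n : ℕ) :
    ‖((cfWordSL d n • UpperHalfPlane.I : UpperHalfPlane) : ℂ) - (cfConv d (2 * n) : ℂ)‖ ≤
      1 / (cfDen d (2 * n) : ℝ) :=
  norm_smul_I_sub_cfConv_le hd (cfWordSL d n) rfl

/-- **`E_A ⊆ Λ(Γ_A)`**: for digits in `A ⊆ ℕ_{≥1}` the value `[0; d 0, d 1, …]` (a point of
`ℝ ⊆ ℂ`) is an accumulation point of the orbit `Γ_A · i`, i.e. lies in the limit set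
`cfLimitSet A`. [cite: MageeOhWinter2019, §1 and §2.1 II] -/
theorem cfValue_mem_cfLimitSet {A : Finset ℕ} (hA : ∀ a ∈ A, 1 ≤ a) {d : ℕ → ℕ}
    (hd : ∀ i, d i ∈ A) : ((cfValue d : ℝ) : ℂ) ∈ cfLimitSet A := by
  have hd1 : ∀ i, 1 ≤ d i := fun i => hA _ (hd i)
  set z : ℕ → ℂ := fun n => ((cfWordSL d (n + 1) • UpperHalfPlane.I : UpperHalfPlane) : ℂ)
    with hz
  have hz_mem : ∀ n, z n ∈ {z : ℂ | ∃ γ : SL(2, ℤ), (γ : Matrix (Fin 2) (Fin 2) ℤ) ∈ cfSemigroup A ∧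
      z = ((γ • UpperHalfPlane.I : UpperHalfPlane) : ℂ)} := fun n =>
    ⟨cfWordSL d (n + 1), cfWord_mem_cfSemigroup hd (by omega) ⟨n + 1, by ring⟩, rfl⟩
  have hz_im : ∀ n, 0 < (z n).im := fun n => (cfWordSL d (n + 1) • UpperHalfPlane.I).im_pos
  -- distance to the limit value
  have hbound : ∀ n, ‖z n - ((cfValue d : ℝ) : ℂ)‖ ≤
      ((1 : ℝ) / 2) ^ (n + 1) + |cfConv d (2 * (n + 1)) - cfValue d| := by
    intro n
    have h1 := norm_cfWordSL_smul_I_sub_le hd1 (n + 1)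
    have h2 : ‖((cfConv d (2 * (n + 1)) : ℝ) : ℂ) - ((cfValue d : ℝ) : ℂ)‖ =
        |cfConv d (2 * (n + 1)) - cfValue d| := by
      rw [← Complex.ofReal_sub, Complex.norm_real, Real.norm_eq_abs]
    have h3 : 1 / (cfDen d (2 * (n + 1)) : ℝ) ≤ ((1 : ℝ) / 2) ^ (n + 1) := by
      have hq : ((2 : ℝ) ^ (n + 1)) ≤ (cfDen d (2 * (n + 1)) : ℝ) := by
        exact_mod_cast pow_le_cfDen_two_mul hd1 (n + 1)
      rw [one_div_pow]
      exact one_div_le_one_div_of_le (by positivity) hq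
    calc ‖z n - ((cfValue d : ℝ) : ℂ)‖
        ≤ ‖z n - ((cfConv d (2 * (n + 1)) : ℝ) : ℂ)‖ +
            ‖((cfConv d (2 * (n + 1)) : ℝ) : ℂ) - ((cfValue d : ℝ) : ℂ)‖ := norm_sub_le_norm_sub_add_norm_sub _ _ _
      _ ≤ ((1 : ℝ) / 2) ^ (n + 1) + |cfConv d (2 * (n + 1)) - cfValue d| := by
          rw [h2]; exact add_le_add (h1.trans h3) le_rfl
  have hlim : Tendsto z atTop (𝓝 ((cfValue d : ℝ) : ℂ)) := by
    rw [tendsto_iff_norm_sub_tendsto_zero]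
    refine squeeze_zero (fun n => norm_nonneg _) hbound ?_
    rw [← zero_add (0 : ℝ)]
    refine Tendsto.add ?_ ?_
    · exact (tendsto_pow_atTop_nhds_zero_of_lt_one (by norm_num) (by norm_num)).comp
        (tendsto_add_atTop_nat 1)
    · have hk : Tendsto (fun n : ℕ => 2 * (n + 1)) atTop atTop :=
        tendsto_atTop_atTop.2 fun b => ⟨b, fun n hn => by omega⟩
      have h := (tendsto_cfConv_cfValue hd1).comp hk
      rw [tendsto_iff_norm_sub_tendsto_zero] at h
      simpa [Real.norm_eq_abs] using h
  -- accumulation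
  rw [cfLimitSet, mem_derivedSet, accPt_iff_nhds]
  intro U hU
  obtain ⟨N, hN⟩ := eventually_atTop.1 (hlim.eventually_mem hU)
  refine ⟨z N, ⟨hN N le_rfl, hz_mem N⟩, fun h => ?_⟩
  have := hz_im N
  rw [h, Complex.ofReal_im] at this
  exact lt_irrefl _ this

/-! ### The target Cantor dust and its coding -/

/-- The two translations `0, 1` of the target Cantor dust (binary digits read in base `3`).
[folklore] -/
def dustDigit : Fin 2 → ℝ := fun i => ((i : ℕ) : ℝ)

/-- The coding map `ω ↦ Σ_k ω_k 3^{-k}` of the Cantor dust with ratio `1/3` and digits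
`{0, 1}` (`CantorDust.code`). [folklore] -/
def dustCode (ω : ℕ → Fin 2) : ℝ := CantorDust.code (1 / 3 : ℝ) dustDigit ω

/-- `dustDigit i ∈ {0, 1}`: `0 ≤ dustDigit i ≤ 1`. [folklore] -/
theorem dustDigit_mem_Icc (i : Fin 2) : dustDigit i ∈ Icc (0 : ℝ) 1 := by
  refine ⟨by simp [dustDigit], ?_⟩
  have : (i : ℕ) ≤ 1 := Nat.lt_succ_iff.1 i.2
  simpa [dustDigit] using (show ((i : ℕ) : ℝ) ≤ 1 by exact_mod_cast this)

/-- Moran's bound for the target dust: `dim_H (range dustCode) ≥ 1/2`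
(`(1/3)^{1/2} · 2 ≥ 1`, strong separation `1/3 · 1 < 1 · (1 - 1/3)`). [folklore] -/
theorem half_le_dimH_range_dustCode : ENNReal.ofReal (1 / 2) ≤ dimH (range dustCode) := by
  have hD : ∀ n n' : Fin 2, ‖dustDigit n - dustDigit n'‖ ≤ 1 := by
    intro n n'; fin_cases n <;> fin_cases n' <;> simp [dustDigit]
  have hδ : ∀ n n' : Fin 2, n ≠ n' → (1 : ℝ) ≤ ‖dustDigit n - dustDigit n'‖ := by
    intro n n' h; fin_cases n <;> fin_cases n' <;> simp_all [dustDigit]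
  have hsM : (1 : ℝ) ≤ (1 / 3 : ℝ) ^ (1 / 2 : ℝ) * (2 : ℕ) := by
    have h14 : (1 / 4 : ℝ) ^ (1 / 2 : ℝ) = 1 / 2 := by
      rw [show (1 / 4 : ℝ) = (1 / 2) ^ (2 : ℝ) by rw [Real.rpow_two]; norm_num,
        ← Real.rpow_mul (by norm_num)]
      norm_num
    have hle : (1 / 4 : ℝ) ^ (1 / 2 : ℝ) ≤ (1 / 3 : ℝ) ^ (1 / 2 : ℝ) :=
      Real.rpow_le_rpow (by norm_num) (by norm_num) (by norm_num)
    rw [h14] at hle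
    push_cast
    linarith
  have h := CantorDust.le_dimH_range_code (E := ℝ) (τ := 1 / 3) (d := dustDigit)
    (by norm_num) (by norm_num) hD hδ (by norm_num) (s := 1 / 2) (by norm_num) hsM
  exact h

/-- `0 ≤ dustCode ω ≤ 3/2`. [folklore] -/
theorem dustCode_mem_Icc (ω : ℕ → Fin 2) : dustCode ω ∈ Icc (0 : ℝ) (3 / 2) := by
  have h3 : (0 : ℝ) ≤ 1 / 3 := by norm_num
  have h3' : (1 / 3 : ℝ) < 1 := by norm_num
  have hs := CantorDust.summable_code (d := dustDigit) h3 h3' ω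
  have hterm : ∀ k, 0 ≤ (1 / 3 : ℝ) ^ k • dustDigit (ω k) ∧
      (1 / 3 : ℝ) ^ k • dustDigit (ω k) ≤ (1 / 3 : ℝ) ^ k := fun k => by
    have hdk := dustDigit_mem_Icc (ω k)
    rw [smul_eq_mul]
    exact ⟨mul_nonneg (pow_nonneg h3 k) hdk.1, mul_le_of_le_one_right (pow_nonneg h3 k) hdk.2⟩
  refine ⟨tsum_nonneg fun k => (hterm k).1, ?_⟩
  calc dustCode ω = ∑' k, (1 / 3 : ℝ) ^ k • dustDigit (ω k) := rfl
    _ ≤ ∑' k, (1 / 3 : ℝ) ^ k :=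
        hs.tsum_le_tsum (fun k => (hterm k).2) (summable_geometric_of_lt_one h3 h3')
    _ = 3 / 2 := by rw [tsum_geometric_of_lt_one h3 h3']; norm_num

/-- Codes agreeing before place `n` give dust points `≤ (3/2) 3^{-n}` apart. [folklore] -/
theorem abs_dustCode_sub_le {ω ω' : ℕ → Fin 2} {n : ℕ} (h : ∀ i < n, ω i = ω' i) :
    |dustCode ω - dustCode ω'| ≤ 3 / 2 * (1 / 3 : ℝ) ^ n := by
  have h3 : (0 : ℝ) ≤ 1 / 3 := by norm_num
  have h3' : (1 / 3 : ℝ) < 1 := by norm_num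
  have e1 := CantorDust.code_eq_word_code (d := dustDigit) h3 h3' ω n
  have e2 := CantorDust.code_eq_word_code (d := dustDigit) h3 h3' ω' n
  have hw : (fun k : Fin n => ω k) = (fun k : Fin n => ω' k) := funext fun k => h k k.2
  have hb := dustCode_mem_Icc (fun k => ω (k + n))
  have hb' := dustCode_mem_Icc (fun k => ω' (k + n))
  simp only [dustCode] at hb hb'
  rw [dustCode, dustCode, e1, e2, hw]
  simp only [CantorDust.word, smul_eq_mul]
  rw [add_sub_add_right_eq_sub, ← mul_sub, abs_mul, abs_pow, abs_of_nonneg h3, mul_comm]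
  refine mul_le_mul_of_nonneg_right ?_ (pow_nonneg h3 n)
  rw [abs_sub_le_iff]
  constructor <;> linarith [hb.1, hb.2, hb'.1, hb'.2]

/-- Two distinct codes have a first place of disagreement. [folklore] -/
theorem binarySeq_exists_first_ne {ω ω' : ℕ → Fin 2} (h : ω ≠ ω') :
    ∃ n, (∀ i < n, ω i = ω' i) ∧ ω n ≠ ω' n := by
  classical
  have hex : ∃ n, ω n ≠ ω' n := Function.ne_iff.1 h
  exact ⟨Nat.find hex, fun i hi => by simpa using Nat.find_min hex hi, Nat.find_spec hex⟩

/-! ### Positivity of `δ_A` -/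

/-- **`δ_A > 0`** (the first conjunct of `MageeOhWinter2019_uniformCounting`, proved): for a
finite set `A` of at least two positive integers, the limit set of the continued fractions
semigroup `Γ_A` has positive Hausdorff dimension. Proof: Hölder coding of the two-letter
sub-Cantor set `{[0; c(ω_0), c(ω_1), …]} ⊆ Λ(Γ_A)` onto a Cantor dust of dimension `≥ 1/2`
(see the module docstring). [cite: MageeOhWinter2019, Thm. 1 and Thm. 2] -/
theorem cfDimension_pos {A : Finset ℕ} (hA : ∀ a ∈ A, 1 ≤ a) (h2 : 2 ≤ A.card) :
    0 < cfDimension A := by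
  classical
  obtain ⟨α, hα, β, hβ, hne⟩ := Finset.one_lt_card.1 h2
  -- digits
  let dg : Fin 2 → ℕ := ![α, β]
  have hdg_mem : ∀ i, dg i ∈ A := by intro i; fin_cases i <;> simp [dg, hα, hβ]
  have hdg1 : ∀ i, 1 ≤ dg i := fun i => hA _ (hdg_mem i)
  set B : ℕ := max α β with hB
  have hdgB : ∀ i, dg i ≤ B := by intro i; fin_cases i <;> simp [dg, hB]
  have hdg_ne : ∀ i j : Fin 2, i ≠ j → dg i ≠ dg j := by
    intro i j hij; fin_cases i <;> fin_cases j <;> simp_all [dg, eq_comm]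
  -- the coding map `K ω = [0; dg (ω 0), dg (ω 1), …]`
  let K : (ℕ → Fin 2) → ℝ := fun ω => cfValue (fun i => dg (ω i))
  -- constants
  set L : ℝ := ((B : ℝ) + 1) ^ 2 with hL
  have hB1 : (1 : ℝ) ≤ B := by
    have : 1 ≤ B := (hdg1 0).trans (hdgB 0)
    exact_mod_cast this
  have hL1 : 1 < L := by rw [hL]; nlinarith
  have hL0 : 0 < L := zero_lt_one.trans hL1
  set r : ℝ := Real.log 3 / Real.log L with hr
  have hlogL : 0 < Real.log L := Real.log_pos hL1
  have hr0 : 0 < r := div_pos (Real.log_pos (by norm_num)) hlogL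
  have hLr : L ^ r = 3 := by
    rw [Real.rpow_def_of_pos hL0, hr, mul_div_cancel₀ _ hlogL.ne', Real.exp_log (by norm_num)]
  have hpow : ∀ n : ℕ, (1 / 3 : ℝ) ^ n = ((L ^ n)⁻¹) ^ r := by
    intro n
    rw [Real.inv_rpow (pow_nonneg hL0.le n), ← Real.rpow_natCast L n, ← Real.rpow_mul hL0.le,
      mul_comm, Real.rpow_mul hL0.le, hLr, Real.rpow_natCast, one_div, inv_pow]
  set c₀ : ℝ := 1 / (((B : ℝ) + 1) ^ 2 * ((B : ℝ) + 2)) / 4 with hc₀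
  have hc₀pos : 0 < c₀ := by rw [hc₀]; positivity
  set C : ℝ := 3 / 2 / c₀ ^ r with hC
  have hC0 : 0 ≤ C := by rw [hC]; positivity
  -- separation of `K` and contraction of `dustCode`
  have hkey : ∀ ω ω', |dustCode ω - dustCode ω'| ≤ C * |K ω - K ω'| ^ r := by
    intro ω ω'
    by_cases hωω : ω = ω'
    · subst hωω; simp only [sub_self, abs_zero]; positivity
    obtain ⟨n, hagree, hdiff⟩ := binarySeq_exists_first_ne hωω
    have hsep : c₀ * (L ^ n)⁻¹ ≤ |K ω - K ω'| := by
      have h := cfValue_separation (d := fun i => dg (ω i)) (d' := fun i => dg (ω' i))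
        (fun i => hdg1 _) (fun i => hdg1 _) (fun i => hdgB _) (fun i => hdgB _) (n := n)
        (fun i hi => by simp [hagree i hi]) (hdg_ne _ _ hdiff)
      have he : c₀ * (L ^ n)⁻¹ =
          1 / (((B : ℝ) + 1) ^ 2 * ((B : ℝ) + 2)) / (4 * (((B : ℝ) + 1) ^ 2) ^ n) := by
        rw [hc₀, hL]
        field_simp
      rw [he]
      exact h
    have hcode : |dustCode ω - dustCode ω'| ≤ 3 / 2 * (1 / 3 : ℝ) ^ n := abs_dustCode_sub_le hagree
    have hinv : (L ^ n)⁻¹ ≤ |K ω - K ω'| / c₀ := by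
      rw [le_div_iff₀ hc₀pos, mul_comm]; exact hsep
    have hrp : ((L ^ n)⁻¹) ^ r ≤ (|K ω - K ω'| / c₀) ^ r :=
      Real.rpow_le_rpow (inv_nonneg.2 (pow_nonneg hL0.le n)) hinv hr0.le
    rw [Real.div_rpow (abs_nonneg _) hc₀pos.le] at hrp
    calc |dustCode ω - dustCode ω'| ≤ 3 / 2 * (1 / 3 : ℝ) ^ n := hcode
      _ = 3 / 2 * ((L ^ n)⁻¹) ^ r := by rw [hpow]
      _ ≤ 3 / 2 * (|K ω - K ω'| ^ r / c₀ ^ r) :=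
          mul_le_mul_of_nonneg_left hrp (by norm_num)
      _ = C * |K ω - K ω'| ^ r := by rw [hC]; ring
  -- the coded set `S ⊆ Λ(Γ_A)` and the Hölder map `F = dustCode ∘ K⁻¹` on it
  set S : Set ℂ := range fun ω : ℕ → Fin 2 => ((K ω : ℝ) : ℂ) with hS
  have hSsub : S ⊆ cfLimitSet A := by
    rintro _ ⟨ω, rfl⟩
    exact cfValue_mem_cfLimitSet hA fun i => hdg_mem (ω i)
  let sec : ℂ → (ℕ → Fin 2) := fun z =>
    if h : ∃ ω : ℕ → Fin 2, ((K ω : ℝ) : ℂ) = z then h.choose else fun _ => 0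
  have hsec : ∀ ω, K (sec ((K ω : ℝ) : ℂ)) = K ω := by
    intro ω
    have hex : ∃ ω' : ℕ → Fin 2, ((K ω' : ℝ) : ℂ) = ((K ω : ℝ) : ℂ) := ⟨ω, rfl⟩
    have hs : sec ((K ω : ℝ) : ℂ) = hex.choose := dif_pos hex
    rw [hs]
    exact Complex.ofReal_injective hex.choose_spec
  let F : ℂ → ℝ := fun z => dustCode (sec z)
  have hF : ∀ ω, F ((K ω : ℝ) : ℂ) = dustCode ω := by
    intro ω
    have h := hkey (sec ((K ω : ℝ) : ℂ)) ω
    rw [hsec ω, sub_self, abs_zero, Real.zero_rpow hr0.ne', mul_zero] at h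
    exact eq_of_abs_sub_nonpos h
  obtain ⟨r', hr'⟩ : ∃ r' : ℝ≥0, (r' : ℝ) = r := ⟨⟨r, hr0.le⟩, rfl⟩
  obtain ⟨C', hC'⟩ : ∃ C' : ℝ≥0, (C' : ℝ) = C := ⟨⟨C, hC0⟩, rfl⟩
  have hrpos : 0 < r' := by rw [← NNReal.coe_pos, hr']; exact hr0
  have hHolder : HolderOnWith C' r' F S := by
    rintro _ ⟨ω, rfl⟩ _ ⟨ω', rfl⟩
    beta_reduce
    rw [edist_dist, edist_dist, ENNReal.coe_nnreal_eq, hr', hC',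
      ENNReal.ofReal_rpow_of_nonneg dist_nonneg hr0.le, ← ENNReal.ofReal_mul hC0]
    refine ENNReal.ofReal_le_ofReal ?_
    rw [hF, hF, Real.dist_eq, Complex.dist_eq, ← Complex.ofReal_sub, Complex.norm_real,
      Real.norm_eq_abs]
    exact hkey ω ω'
  have hrange : range dustCode ⊆ F '' S := by
    rintro _ ⟨ω, rfl⟩
    exact ⟨((K ω : ℝ) : ℂ), ⟨ω, rfl⟩, hF ω⟩
  -- dimensions
  have h1 : ENNReal.ofReal (1 / 2) ≤ dimH (cfLimitSet A) / (r' : ℝ≥0∞) :=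
    calc ENNReal.ofReal (1 / 2) ≤ dimH (range dustCode) := half_le_dimH_range_dustCode
      _ ≤ dimH (F '' S) := dimH_mono hrange
      _ ≤ dimH S / (r' : ℝ≥0∞) := hHolder.dimH_image_le hrpos
      _ ≤ dimH (cfLimitSet A) / (r' : ℝ≥0∞) := ENNReal.div_le_div_right (dimH_mono hSsub) _
  have hr'0 : (r' : ℝ≥0∞) ≠ 0 := ENNReal.coe_ne_zero.2 hrpos.ne'
  have h2 : ENNReal.ofReal (1 / 2) * (r' : ℝ≥0∞) ≤ dimH (cfLimitSet A) :=
    (ENNReal.le_div_iff_mul_le (Or.inl hr'0) (Or.inl ENNReal.coe_ne_top)).1 h1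
  have htop : dimH (cfLimitSet A) ≠ ⊤ := Real.dimH_ne_top _
  have h3 := ENNReal.toReal_mono htop h2
  rw [ENNReal.toReal_mul, ENNReal.toReal_ofReal (by norm_num), ENNReal.coe_toReal, hr'] at h3
  have h4 : (0 : ℝ) < 1 / 2 * r := by positivity
  exact h4.trans_le h3


/-- **Reduction of the named fact to its counting conjunct.** With `δ_A > 0` proved
(`cfDimension_pos`), `MageeOhWinter2019_uniformCounting` is EQUIVALENT to its second conjunct
alone: the uniform congruence count `|#{γ ∈ Γ_A : ‖γ‖ ≤ R, γ ≡ ξ (q)} - c R^{2δ_A}/#SL₂(ℤ/q)| ≤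
K q^C R^{2δ_A-ε}` for `(q, Q₀) = 1` [MageeOhWinter2019, Thm. 11 with `G ≡ 1`, `γ₀ = e`; Thm. 1–2],
which is NOT proved here (it rests on the thermodynamic formalism, Lalley's renewal equation,
Dolgopyat–Naud bounds and Bourgain–Gamburd–Sarnak / Bourgain–Varjú expansion, §§2–5 and the
appendix of the paper). [cite: MageeOhWinter2019, Thm. 11] -/
theorem MageeOhWinter2019_uniformCounting_iff_congruenceCount :
    MageeOhWinter2019_uniformCounting ↔
      ∀ A : Finset ℕ, (∀ a ∈ A, 1 ≤ a) → 2 ≤ A.card →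
        ∃ Q₀ : ℕ, 0 < Q₀ ∧ ∃ c : ℝ, 0 < c ∧ ∃ C : ℝ, 0 < C ∧ ∃ ε : ℝ, 0 < ε ∧ ∃ K : ℝ, 0 ≤ K ∧
          ∀ q : ℕ, 0 < q → Nat.Coprime q Q₀ → ∀ (ξ : SL(2, ZMod q)) (R : ℝ), 1 ≤ R →
            |(cfCount A q ξ R : ℝ) -
                c * R ^ (2 * cfDimension A) / (Nat.card (SL(2, ZMod q)) : ℝ)| ≤
              K * (q : ℝ) ^ C * R ^ (2 * cfDimension A - ε) :=
  ⟨fun h A hA h2 => (h A hA h2).2, fun h A hA h2 => ⟨cfDimension_pos hA h2, h A hA h2⟩⟩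

end Literature.NumberTheory.Sieve
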